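import Literature.Computability.Complexity.AffineHashing
import Literature.Computability.AlgebraicComplexity.LaserHashing
import Mathlib.Data.Nat.Log
import Mathlib.Tactic.Linarith
import Mathlib.Tactic.NormNum
import HarnessLib

/-!
# The Valiant–Vazirani isolation lemma (counting form) for the affine hash family

Trunk `CplxCore`, continuing `AffineHashing.lean` (`AffineHash.Hash m k`, `hash h x = A x + b` over
`𝔽₂`, one-point uniformity `card_filter_hash_eq` and pairwise independence `card_filter_hash_pair`).
The combinatorial core of the randomized reduction `NP → ⊕P` in Toda's theorem (Arora–Barak 2009,
Thm. 17.18 and Lemma 17.19; used in Lemma 17.17), stated for that family with target `0^k`: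

* **`valiant_vazirani`** (AB Lemma 17.19: "`2^{k-2} ≤ |S| ≤ 2^{k-1}` … `Pr[there is a unique x ∈ S`
  `satisfying h(x) = 0^k] ≥ 1/8`"), in counting form: `8 · #{h | exactly one x ∈ S has h(x) = 0}`
  `≥ |ℋ|` (indeed `6 ·` suffices). Proof as printed (p. 418, inclusion–exclusion): the functions
  isolating a given `x` are at least `N_x - Σ_{x' ≠ x} N_{x,x'}` with `N_x = |ℋ| 2^{-k}`
  (`card_filter_hash_eq`) and `N_{x,x'} = |ℋ| 4^{-k}` (`card_filter_hash_pair`), these events are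
  disjoint over `x ∈ S`, and `|S| 2^{-k} - |S|² 4^{-k} ≥ 1/8` in the stated range;
* `valiant_vazirani_odd` — a fortiori the number of zeros in `S` is odd for at least a `1/8`
  fraction ("1 is odd", AB Cor. 17.20; for `S = ∅` it is `0`, never odd); this one-sided parity test
  is what the `⊕` quantifier consumes;
* **levels**: the machine of Lemma 17.17 draws one `K`-row hash `h ∈ ℋ_{m,K}` (`K = n + 2`) and uses
  its first `k` rows for each level `k ≤ K` (AB, proof of Thm. 17.18: "choose `k` at random from
  `{2, …, n+1}`" — trying all levels only improves the bound): `trunc hk : Hash m K →+ Hash m k`, onto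
  (`trunc_surjective`), `hash_trunc_apply`; pushing an event forward along an onto homomorphism
  preserves its density (`card_filter_comp_mul_card`, from the fibre count of
  `AlgebraicComplexity/LaserHashing.lean`), whence the level form `valiant_vazirani_odd_level` over
  `ℋ_{m,K}`;
* `exists_goodLevel` — every `1 ≤ s ≤ 2^n` has a level `k ≤ n + 2` with `2^{k-2} ≤ s ≤ 2^{k-1}`
  (`k = ⌊log₂ s⌋ + 2`).

## References

* L. G. Valiant, V. V. Vazirani, *NP is as easy as detecting unique solutions*, Theoret. Comput.
  Sci. 47 (1986) 85–93.
* S. Arora, B. Barak, *Computational Complexity: A Modern Approach*, CUP 2009, Thm. 17.18,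
  Lemma 17.19 (p. 418), proof of Thm. 17.18 (p. 419), Cor. 17.20; Def. 8.14 (the family).
-/

namespace Literature.Computability.Complexity

open Finset

namespace AffineHash

variable {m k K : ℕ}

/-! ### The isolation lemma -/

/-- **The Valiant–Vazirani Lemma** (counting form, affine family, target `0`). If `2^k ≤ 4|S|` and
`2|S| ≤ 2^k` (i.e. `2^{k-2} ≤ |S| ≤ 2^{k-1}`) then at least a `1/8` fraction (in fact `1/6`) of the
hash functions `h ∈ ℋ_{m,k}` has a unique `x ∈ S` with `h(x) = 0`. (AB Lemma 17.19: "`Pr[there is a`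
`unique x ∈ S satisfying h(x) = 0^k] ≥ 1/8`"; proof by inclusion–exclusion, p. 418, from one-point
uniformity and pairwise independence.) [cite: AroraBarak2009, Lemma 17.19] -/
theorem valiant_vazirani (S : Finset (Fin m → ZMod 2)) (hlo : 2 ^ k ≤ 4 * S.card) (hhi : 2 * S.card ≤ 2 ^ k) :
    Fintype.card (Hash m k) ≤
      8 * (univ.filter fun h : Hash m k => (S.filter fun x => hash h x = 0).card = 1).card := by
  set T := Fintype.card (Hash m k) with hT
  set U := univ.filter fun h : Hash m k => (S.filter fun x => hash h x = 0).card = 1 with hU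
  -- the functions isolating `y`
  let V : (Fin m → ZMod 2) → Finset (Hash m k) := fun y =>
    univ.filter fun h => hash h y = 0 ∧ ∀ y' ∈ S, y' ≠ y → hash h y' ≠ 0
  let W₁ : (Fin m → ZMod 2) → Finset (Hash m k) := fun y => univ.filter fun h => hash h y = 0
  let W₂ : (Fin m → ZMod 2) → (Fin m → ZMod 2) → Finset (Hash m k) :=
    fun y y' => univ.filter fun h => hash h y = 0 ∧ hash h y' = 0
  -- (1) isolating functions are in `U`, disjointly over `y ∈ S`
  have hVU : ∀ y ∈ S, V y ⊆ U := by
    intro y hy h hh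
    rw [hU, mem_filter]
    refine ⟨mem_univ _, card_eq_one.2 ⟨y, ?_⟩⟩
    obtain ⟨hh1, hh2⟩ := (mem_filter.1 hh).2
    ext y'
    simp only [mem_filter, mem_singleton]
    constructor
    · rintro ⟨hy', hA'⟩
      by_contra hne
      exact hh2 y' hy' hne hA'
    · rintro rfl; exact ⟨hy, hh1⟩
  have hdisj : (S : Set (Fin m → ZMod 2)).PairwiseDisjoint V := by
    intro y₁ h₁ y₂ h₂ hne
    refine disjoint_left.2 fun h hh₁ hh₂ => ?_
    have h1 := (mem_filter.1 hh₁).2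
    have h2 := (mem_filter.1 hh₂).2
    exact h1.2 y₂ h₂ (Ne.symm hne) h2.1
  have hUge : ∑ y ∈ S, (V y).card ≤ U.card := by
    rw [← card_biUnion hdisj]
    exact card_le_card (biUnion_subset.2 hVU)
  -- (2) inclusion–exclusion for each `y`
  have hVy : ∀ y ∈ S, (W₁ y).card ≤ (V y).card + ∑ y' ∈ S.erase y, (W₂ y y').card := by
    intro y hy
    have hsub : W₁ y ⊆ V y ∪ (S.erase y).biUnion (W₂ y) := by
      intro h hh
      have hhy : hash h y = 0 := (mem_filter.1 hh).2
      by_cases hiso : ∀ y' ∈ S, y' ≠ y → hash h y' ≠ 0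
      · exact mem_union_left _ (mem_filter.2 ⟨mem_univ _, hhy, hiso⟩)
      · simp only [not_forall, not_not, exists_prop] at hiso
        obtain ⟨y', hy'S, hne, hA'⟩ := hiso
        exact mem_union_right _ (mem_biUnion.2 ⟨y', mem_erase.2 ⟨hne, hy'S⟩, mem_filter.2 ⟨mem_univ _, hhy, hA'⟩⟩)
    exact (card_le_card hsub).trans ((card_union_le _ _).trans (Nat.add_le_add_left card_biUnion_le _))
  -- (3) multiply by `4^k` and use one-point uniformity and pairwise independence
  have hW₁ : ∀ y, (W₁ y).card * 4 ^ k = 2 ^ k * T := by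
    intro y
    rw [show (4 : ℕ) ^ k = 2 ^ k * 2 ^ k by rw [← mul_pow]; norm_num, ← mul_assoc, card_filter_hash_eq y 0, hT]
    ring
  have hW₂ : ∀ y ∈ S, ∀ y' ∈ S.erase y, (W₂ y y').card * 4 ^ k = T := by
    intro y _ y' hy'
    rw [show (4 : ℕ) ^ k = 2 ^ k * 2 ^ k by rw [← mul_pow]; norm_num]
    exact card_filter_hash_pair (Ne.symm (ne_of_mem_erase hy')) 0 0
  have hy4 : ∀ y ∈ S, 2 ^ k * T ≤ (V y).card * 4 ^ k + (S.card - 1) * T := by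
    intro y hy
    have h := Nat.mul_le_mul_right (4 ^ k) (hVy y hy)
    rw [hW₁ y, Nat.add_mul, sum_mul, sum_congr rfl (hW₂ y hy), sum_const, card_erase_of_mem hy,
      smul_eq_mul] at h
    exact h
  have hsum : S.card * (2 ^ k * T) ≤ (∑ y ∈ S, (V y).card) * 4 ^ k + S.card * ((S.card - 1) * T) := by
    have := sum_le_sum hy4
    rw [sum_const, smul_eq_mul, sum_add_distrib, sum_const, smul_eq_mul, ← sum_mul] at this
    exact this
  have hmain : S.card * (2 ^ k * T) ≤ U.card * 4 ^ k + S.card * ((S.card - 1) * T) :=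
    hsum.trans (Nat.add_le_add_right (Nat.mul_le_mul_right _ hUge) _)
  -- (4) arithmetic: with `a = 2^k`, `s = |S|`, `a ≤ 4s`, `2s ≤ a`: `T ≤ 8 #U`
  set s := S.card with hs
  set a := 2 ^ k with ha
  have h4 : (4 : ℕ) ^ k = a * a := by rw [ha, ← mul_pow]; norm_num
  rw [h4] at hmain
  have hs1 : 1 ≤ s := by
    have : 0 < a := by rw [ha]; positivity
    omega
  obtain ⟨d, hd⟩ : ∃ d, a = s + d := ⟨a - s, by omega⟩
  rw [hd] at hmain hlo hhi
  -- `s (s+d) T ≤ U (s+d)² + s (s-1) T`, `d ≤ 3 s`, `s ≤ d`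
  have hsd : s ≤ d := by omega
  have hd3 : d ≤ 3 * s := by omega
  have key : s * d * T ≤ U.card * ((s + d) * (s + d)) := by
    have h1 : s * ((s - 1) * T) + s * d * T + s * T = s * ((s + d) * T) := by
      obtain ⟨s', hs'⟩ : ∃ s', s = s' + 1 := ⟨s - 1, by omega⟩
      rw [hs', Nat.add_sub_cancel]; ring
    nlinarith [hmain, h1]
  have key2 : (s + d) * (s + d) ≤ 6 * (s * d) := by nlinarith
  have hpos : 0 < (s + d) * (s + d) := by positivity
  by_contra hlt
  rw [not_le] at hlt
  -- `8 #U < T` contradicts `s d T ≤ #U (s+d)² ≤ 6 s d #U < s d T`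
  have : U.card * ((s + d) * (s + d)) < s * d * T := by
    calc U.card * ((s + d) * (s + d)) ≤ U.card * (6 * (s * d)) := Nat.mul_le_mul_left _ key2
      _ = 6 * U.card * (s * d) := by ring
      _ < T * (s * d) := by
          refine Nat.mul_lt_mul_of_pos_right (by omega) ?_
          exact Nat.mul_pos (by omega) (by omega)
      _ = s * d * T := by ring
  omega

/-- **The parity form** (one-sided): under the same hypotheses, for at least a `1/8` fraction of the
hash functions the number of `x ∈ S` with `h(x) = 0` is odd (`1` is odd). [Arora–Barak 2009,
Cor. 17.20 ("1 is an odd number")] [cite: AroraBarak2009, Cor. 17.20] -/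
theorem valiant_vazirani_odd (S : Finset (Fin m → ZMod 2)) (hlo : 2 ^ k ≤ 4 * S.card) (hhi : 2 * S.card ≤ 2 ^ k) :
    Fintype.card (Hash m k) ≤
      8 * (univ.filter fun h : Hash m k => Odd (S.filter fun x => hash h x = 0).card).card := by
  refine (valiant_vazirani S hlo hhi).trans (Nat.mul_le_mul_left 8 (card_le_card fun h hh => ?_))
  rw [mem_filter] at hh ⊢
  exact ⟨hh.1, by rw [hh.2]; exact odd_one⟩

/-! ### Levels: the first `k` rows of a `K`-row hash function -/

/-- **Truncation to the first `k` rows**, `(A, b) ↦ (A↾k, b↾k)` for `k ≤ K`, an additive homomorphism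
`ℋ_{m,K} → ℋ_{m,k}`. [Arora–Barak 2009, Thm. 17.18 (proof: the level `k` of one random hash)]
[cite: AroraBarak2009, Thm. 17.18 (proof)] -/
def trunc (hk : k ≤ K) : Hash m K →+ Hash m k where
  toFun h := (h.1.submatrix (Fin.castLE hk) id, fun ρ => h.2 (Fin.castLE hk ρ))
  map_zero' := rfl
  map_add' _ _ := rfl

/-- The value of `trunc`. [folklore] -/
theorem trunc_apply (hk : k ≤ K) (h : Hash m K) :
    trunc hk h = (h.1.submatrix (Fin.castLE hk) id, fun ρ => h.2 (Fin.castLE hk ρ)) := rfl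

/-- **The truncated hash value is the truncation of the hash value**: `(h↾k)(x)_ρ = h(x)_ρ`.
[folklore] -/
theorem hash_trunc_apply (hk : k ≤ K) (h : Hash m K) (x : Fin m → ZMod 2) (ρ : Fin k) :
    hash (trunc hk h) x ρ = hash h x (Fin.castLE hk ρ) := by
  simp [hash, trunc_apply, Matrix.mulVec, dotProduct, Matrix.submatrix]

/-- Truncation is onto (extend by zero rows). [folklore] -/
theorem trunc_surjective (hk : k ≤ K) : Function.Surjective (trunc (m := m) hk) := by
  rintro ⟨A', b'⟩
  refine ⟨(Matrix.of fun ρ c => if h : (ρ : ℕ) < k then A' ⟨ρ, h⟩ c else 0,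
    fun ρ => if h : (ρ : ℕ) < k then b' ⟨ρ, h⟩ else 0), ?_⟩
  rw [trunc_apply, Prod.mk.injEq]
  constructor
  · ext ρ c
    simp [Matrix.submatrix]
  · funext ρ
    simp

/-- **Pushing an event forward along an onto homomorphism preserves its density**:
`#{g | P (f g)} · |H| = #{h | P h} · |G|` (all fibres of `f` have the same size,
`Literature.Computability.AlgebraicComplexity.card_filter_mul_card_eq_card_of_surjective`). [folklore] -/
theorem card_filter_comp_mul_card {G H : Type*} [AddCommGroup G] [Fintype G] [AddCommGroup H] [Fintype H]
    [DecidableEq H] (f : G →+ H) (hf : Function.Surjective f) (P : H → Prop) [DecidablePred P] :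
    (univ.filter fun g => P (f g)).card * Fintype.card H = (univ.filter P).card * Fintype.card G := by
  classical
  have hfib : ∀ y : H, (univ.filter fun g => f g = y).card * Fintype.card H = Fintype.card G :=
    fun y => Literature.Computability.AlgebraicComplexity.card_filter_mul_card_eq_card_of_surjective f hf y
  -- decompose `{g | P (f g)}` along the fibres over `{h | P h}`
  have hdec : (univ.filter fun g => P (f g)).card = ∑ y ∈ univ.filter P, (univ.filter fun g => f g = y).card := by
    rw [card_eq_sum_card_fiberwise (f := f) (t := univ.filter P) fun g hg => by
      rw [Finset.mem_coe, mem_filter] at hg ⊢; exact ⟨mem_univ _, hg.2⟩]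
    refine sum_congr rfl fun y hy => ?_
    congr 1
    ext g
    simp only [mem_filter, mem_univ, true_and]
    constructor
    · exact fun h => h.2
    · intro h; rw [mem_filter] at hy; exact ⟨h ▸ hy.2, h⟩
  rw [hdec, sum_mul, sum_congr rfl fun y _ => hfib y, sum_const, smul_eq_mul]

/-- **The level-`k` form over `K`-row hash functions**: if `2^{k-2} ≤ |S| ≤ 2^{k-1}` and `k ≤ K`, for at
least a `1/8` fraction of `h ∈ ℋ_{m,K}` the number of `x ∈ S` with `(h↾k)(x) = 0` is odd.
[Arora–Barak 2009, Thm. 17.18 (proof) with Cor. 17.20] [cite: AroraBarak2009, Thm. 17.18 (proof)] -/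
theorem valiant_vazirani_odd_level (S : Finset (Fin m → ZMod 2)) (hk : k ≤ K) (hlo : 2 ^ k ≤ 4 * S.card)
    (hhi : 2 * S.card ≤ 2 ^ k) :
    Fintype.card (Hash m K) ≤
      8 * (univ.filter fun h : Hash m K => Odd (S.filter fun x => hash (trunc hk h) x = 0).card).card := by
  classical
  have hpush := card_filter_comp_mul_card (trunc (m := m) hk) (trunc_surjective hk)
    (fun h' : Hash m k => Odd (S.filter fun x => hash h' x = 0).card)
  have hvv := valiant_vazirani_odd S hlo hhi
  have hpos : 0 < Fintype.card (Hash m k) := Fintype.card_pos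
  -- `8 #{h} |ℋ_k| = 8 #{h'} |ℋ_K| ≥ |ℋ_k| |ℋ_K|`
  refine Nat.le_of_mul_le_mul_right ?_ hpos
  calc Fintype.card (Hash m K) * Fintype.card (Hash m k)
      ≤ (8 * (univ.filter fun h' : Hash m k => Odd (S.filter fun x => hash h' x = 0).card).card) *
          Fintype.card (Hash m K) := by rw [mul_comm]; exact Nat.mul_le_mul_right _ hvv
    _ = 8 * ((univ.filter fun h : Hash m K => Odd (S.filter fun x => hash (trunc hk h) x = 0).card).card *
          Fintype.card (Hash m k)) := by rw [mul_assoc, ← hpush]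
    _ = 8 * (univ.filter fun h : Hash m K => Odd (S.filter fun x => hash (trunc hk h) x = 0).card).card *
          Fintype.card (Hash m k) := by ring

/-! ### Good levels -/

/-- **Every `1 ≤ s ≤ 2^n` has a good level `k ≤ n + 2`** (`2^{k-2} ≤ s ≤ 2^{k-1}` with
`k = ⌊log₂ s⌋ + 2`). [Arora–Barak 2009, proof of Thm. 17.18 ("with probability at least `1/n`, `k`
satisfies `2^{k-2} ≤ |S| ≤ 2^{k-1}`")] [cite: AroraBarak2009, Thm. 17.18 (proof)] -/
theorem exists_goodLevel {n s : ℕ} (h1 : 1 ≤ s) (h2 : s ≤ 2 ^ n) :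
    ∃ k ≤ n + 2, 2 ^ k ≤ 4 * s ∧ 2 * s ≤ 2 ^ k := by
  have hpos : s ≠ 0 := by omega
  refine ⟨Nat.log 2 s + 2, ?_, ?_, ?_⟩
  · have : Nat.log 2 s ≤ n := by
      calc Nat.log 2 s ≤ Nat.log 2 (2 ^ n) := Nat.log_mono_right h2
        _ = n := Nat.log_pow (by norm_num) n
    omega
  · rw [pow_add]
    have := Nat.pow_log_le_self 2 hpos
    omega
  · rw [pow_add]
    have := Nat.lt_pow_succ_log_self (b := 2) (by norm_num) s
    rw [pow_succ] at this
    omega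

end AffineHash

end Literature.Computability.Complexity
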